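import Summits.NavierStokesRegularity.NavierStokesRegularity.Theorems.FilamentSkeletonRssSkeletonJ1RLineDefs
import Summits.NavierStokesRegularity.NavierStokesRegularity.Theorems.FilamentSkeletonRssSkeletonJ1RFarTools
import Summits.NavierStokesRegularity.NavierStokesRegularity.Theorems.FilamentSkeletonRssSkeletonJ1RFineTools

/-!
# Route `FilamentSkeletonRss` · crux `SkeletonJ1R` (stmt-NavierStokesRegularity-23610) · STUB D `FlatOutputL` — the BOOKKEEPING
# (registered line `streamline_kantorovich_R`, sha16 `cbdaf3778dcf417e`; byte-identical stub of the shelf line `lia_switchoff_degree_R`)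

`flatOutputL_of_frame` proves, over the frame vocabulary of `…SkeletonJ1RFrameDefs` (lead `ns-fsr-lead-23610`, p711824/p712722), the text of the
record skeleton's stub statement `FlatOutputL` (cbdaf3778dcf, `AdmissibleFrame`) VERBATIM as its goal type, `flatOutputL_of_slicedFrame` the lead's
reshaped text (`SlicedFrame`, = `…SkeletonJ1RLineDefs.FlatOutputL`, p715100), and the last declaration is the registered stub BY NAME,
`SkeletonJ1RFrame.stub_flatOutputL : FlatOutputL`: a FINE
switched-tangent skeleton at homotopy time `s = 1` with regular waists, in an admissible frame over a general-position straight datum,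
satisfies the flat clause block `FlatJ1L` and the near-straight regime `NearStraightJ1G` with
`w :=` the TRUE slip `⟪trueField(X_jτ), X_j′τ⟫`, `c := 0`, rigid unit cores `Aa := 1`, and the datum-derived constants
`δ := δd/2`, `ρ := min (ρd/4) (1/2)`, `K := Rb₁`, `Λ := max (Λd+1) 1`, `Rw := Rwd+1`, `cg := 1/2`, `θ₀ := θd/2`, `KA := 1`,
`Rb₁ := min (θd/6) (min (ρd/8) 1)`, `Γ₃ := exp((Q/Rb)² + 1)` with `Q := (Rwd+1)(5 + 8θd⁻¹) + 8·Cu + 1`,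
`Cu := N·θd⁻¹·(4Rb + 32/(πρd))` (the uniform tangential Biot–Savart constant: `|⟪u_X(X_jτ), X_j′τ⟫| ≤ Cu√Γ`).
The clauses: 0 (ranges) from `StraightDatum`; 1 (regularity, curvature `≤ Rb ≤ Rb₁ = K`, escape) from `SwitchedTangent`/`FineClass`;
2 (separation `(ρd/2 − 2Rb)√Γ ≥ (ρd/4)√Γ`), 3 (chord–arc `½`) and the tangent oscillation `3Rb/4 ≤ Rb` from the fine tilt `Rb/4` + reference
tilt `Rb/8` (`…SkeletonJ1RFineTools`); 4 (box) and 7 (waist norm `(Rwd+1)√Γ`) from unit speed and `‖X_j0 − x_j0‖ ≤ Rb√Γ`,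
`x_j 0 = √Γ(p_j + s₀_j t_j)`; 5/6/9 (slip definition, tangency on the crux ball, slip slopes): on the ball `‖y‖ ≤ ℓ = Rb√(Γ log Γ)` the switch
weight is `1`, so the switched field IS the true field (`switchWeight_eq_one_of_sq_le` of the Defs file) and switched tangency is clause 9,
the waist zero `X_j 0` (norm `≤ (Rwd+1)√Γ < ℓ`) is a true-slip zero, and `RegularWaist` gives uniqueness of the slip zero ON the ball;
OFF the ball the true slip does not vanish by `trueSlip_ne_zero_of_far` (drift `≥ |τ|/8 − (½+|α|)‖X_j0‖` against `Cu√Γ`, which is why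
`Γ ≥ Γ₃(Rb)`); 8 (tilt `1 − θd + 3Rb/8 ≤ 1 − θd/2`); 10/11 (rigid unit cores, `KA = 1`) trivially; `NearStraightJ1G` from the oscillation,
`|w′| ≤ Λd + 1 ≤ Λ` and `Λ⁻¹ ≤ 1 = Aa`.
HONEST FRAMING: MODEL rung, ∃-side BOOKKEEPING stub of a HYPOTHETICAL filament-type rotating-self-similar blow-up skeleton — it closes no item
(`--supports stmt-NavierStokesRegularity-23610`); the hard stubs F/L/K of the line and the crux 23610 stay OPEN; nothing here bears on
Navier–Stokes regularity, which is NOT proved. [folklore]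
-/

-- `dupNamespace` off: the module name repeats `NavierStokesRegularity` by the tree's `Summits/<S>/<S>/Theorems` layout (same as every sibling file).
set_option linter.dupNamespace false

noncomputable section

namespace Summit.NavierStokesRegularity.NavierStokesRegularity.Theorems.SkeletonJ1RFlatOutput

open MeasureTheory Filter Topology
open Literature.Analysis.FluidPDE Literature.Analysis.FluidPDE.Tao2016
open Summit.NavierStokesRegularity.NavierStokesRegularity.Theorems.SkeletonJ1RFrame
open Summit.NavierStokesRegularity.NavierStokesRegularity.Theorems.SkeletonJ1RSlipTools
open Summit.NavierStokesRegularity.NavierStokesRegularity.Theorems.FilamentSkeletonRssSkeletonJ1GSplit (NearStraightJ1G StraightDatum)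
open Summit.NavierStokesRegularity.NavierStokesRegularity.Theorems.FilamentSkeletonRssSkeletonJ1LSplit (FlatJ1L)
open scoped RealInnerProductSpace InnerProductSpace BigOperators

/-! ## §0 The tangential centreline bound for the crux's `bsField` (via `…SkeletonJ1RFarTools`) -/

/-- **Tangential centreline Biot–Savart bound for a fine skeleton.**  For `C²` unit-speed filaments with `‖X_k″‖ ≤ κ₀` (`0 < κ₀`), global
chord–arc constant `c ∈ (0,1]`, separation `≥ d > 0`, `|γ k| ≤ G` and `0 ≤ Γ`:
`|⟪bsField Γ γ X (X_j τ), X_j′ τ⟫| ≤ N · (ΓG/(4π)) · (2πκ₀/c³ + 16/(c d))`, uniformly in `τ`. [folklore] -/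
theorem abs_inner_bsField_le {N : ℕ} {X : Fin N → ℝ → EuclideanSpace ℝ (Fin 3)} (hX : ∀ k, ContDiff ℝ 2 (X k))
    (hunit : ∀ k s, ‖deriv (X k) s‖ = 1) {κ₀ c d Γ G : ℝ} {γ : Fin N → ℝ} (hκ₀ : 0 < κ₀)
    (hκ : ∀ k s, ‖deriv (deriv (X k)) s‖ ≤ κ₀) (hc : 0 < c) (hc1 : c ≤ 1)
    (hchord : ∀ k u t, c * |u - t| ≤ ‖X k u - X k t‖) (hd : 0 < d)
    (hsep : ∀ j k, j ≠ k → ∀ τ σ, d ≤ ‖X j τ - X k σ‖) (hγ : ∀ k, |γ k| ≤ G) (hΓ : 0 ≤ Γ) (j : Fin N) (τ : ℝ) :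
    |⟪bsField Γ γ X (X j τ), deriv (X j) τ⟫| ≤ N * (Γ * G / (4 * Real.pi) * (2 * Real.pi * κ₀ / c ^ 3 + 16 / (c * d))) := by
  -- the core constant `e² = e^{−(1+γ_E−log 2)}·1 > 0` (cf. `SkeletonJ1RFrame.coreConst_pos` of `…SkeletonJ1RLiaReference`)
  have hc0 : 0 < Real.exp (-(1+Real.eulerMascheroniConstant-Real.log 2)) * (1:ℝ) := by rw [mul_one]; exact Real.exp_pos _
  set e : ℝ := Real.sqrt (Real.exp (-(1+Real.eulerMascheroniConstant-Real.log 2)) * (1:ℝ)) with he_def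
  have he2 : Real.exp (-(1+Real.eulerMascheroniConstant-Real.log 2)) * (1:ℝ) = e ^ 2 := by
    rw [he_def, Real.sq_sqrt hc0.le]
  have he : e ≠ 0 := by rw [he_def]; exact (Real.sqrt_pos.2 hc0).ne'
  have hfield : bsField Γ γ X (X j τ) = ∑ k, (Γ * γ k / (4 * Real.pi)) • ∫ σ : ℝ, ((‖X j τ - X k σ‖ ^ 2 + e ^ 2) ^ (3 / 2 : ℝ))⁻¹ •
      cross (deriv (X k) σ) (X j τ - X k σ) := by
    unfold bsField; simp only [he2]
  rw [hfield]
  exact abs_inner_skeletonField_le hX hunit hκ₀ hκ hc hc1 hchord hd hsep hγ hΓ he j τ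

/-- Threshold algebra: for `0 < Rb`, `0 < Q` and `exp((Q/Rb)² + 1) ≤ Γ` one has `1 < Γ` and `Q·√Γ < Rb·√(Γ log Γ)`. [folklore] -/
theorem threshold_ball {Rb Q Γ : ℝ} (hRb : 0 < Rb) (hQ : 0 < Q) (hΓ : Real.exp ((Q / Rb) ^ 2 + 1) ≤ Γ) :
    1 < Γ ∧ Q * Real.sqrt Γ < Rb * Real.sqrt (Γ * Real.log Γ) := by
  have hΓ1 : 1 < Γ := by
    have : (1:ℝ) < Real.exp ((Q / Rb) ^ 2 + 1) := by
      have h := Real.add_one_le_exp ((Q / Rb) ^ 2 + 1)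
      nlinarith [sq_nonneg (Q / Rb)]
    linarith
  have hΓpos : 0 < Γ := by linarith
  have hlog : (Q / Rb) ^ 2 + 1 ≤ Real.log Γ := by
    have := Real.log_le_log (Real.exp_pos _) hΓ
    rwa [Real.log_exp] at this
  refine ⟨hΓ1, ?_⟩
  have h1 : Q / Rb < Real.sqrt (Real.log Γ) := by
    rw [Real.lt_sqrt (div_pos hQ hRb).le]
    linarith
  have h2 : Q < Rb * Real.sqrt (Real.log Γ) := by
    have := mul_lt_mul_of_pos_left h1 hRb
    rwa [mul_div_cancel₀ _ hRb.ne'] at this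
  calc Q * Real.sqrt Γ < Rb * Real.sqrt (Real.log Γ) * Real.sqrt Γ := mul_lt_mul_of_pos_right h2 (Real.sqrt_pos.2 hΓpos)
    _ = Rb * Real.sqrt (Γ * Real.log Γ) := by rw [Real.sqrt_mul hΓpos.le]; ring

/-- **The clause bookkeeping.**  Given the pointwise facts of a fine switched-tangent skeleton with regular waists (datum tilt, tangent
oscillation, chord–arc, separation, waist norms, the switched field = the true field on the crux ball, and far-slip non-vanishing), the
flat clause block `FlatJ1L` and the near-straight regime `NearStraightJ1G` hold with the true slip, `c := 0`, `Aa := 1`. [folklore] -/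
theorem flatJ1L_of_facts {N : ℕ} {Γ δd ρd Λd Rwd θd Rb Rb₁ ℓ : ℝ} {γ : Fin N → ℝ} {α : ℝ} {t : Fin N → EuclideanSpace ℝ (Fin 3)}
    {x X : Fin N → ℝ → EuclideanSpace ℝ (Fin 3)} {M : EuclideanSpace ℝ (Fin 3) → EuclideanSpace ℝ (Fin 3)}
    (hθd : 0 < θd) (hranges : θd ≤ |α| ∧ |α| ≤ θd⁻¹ ∧ ∀ j, θd ≤ |γ j| ∧ |γ j| ≤ θd⁻¹)
    (htilt : ∀ j, |⟪t j, EuclideanSpace.single 2 1⟫_ℝ| ≤ 1 - θd) (hsΓ : 0 < Real.sqrt Γ) (hRb : 0 < Rb) (hRbRb₁ : Rb ≤ Rb₁)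
    (hRbθ : Rb ≤ θd / 6)
    (hℓdef : ℓ = Rb * Real.sqrt (Γ * Real.log Γ))
    (hfine : FineClass Γ δd Λd Rb γ α x X) (htan : SwitchedTangent Γ Rb γ α M 1 X) (hreg : RegularWaist Γ ρd Rb γ α x M 1 X)
    (htilt' : ∀ j τ, ‖deriv (X j) τ - t j‖ ≤ 3 * Rb / 8) (hosc : ∀ j u v, ‖deriv (X j) u - deriv (X j) v‖ ≤ 3 * Rb / 4)
    (hchord : ∀ j u s, 1 / 2 * |u - s| ≤ ‖X j u - X j s‖) (hsep : ∀ j k, j ≠ k → ∀ τ σ, ρd / 4 * Real.sqrt Γ ≤ ‖X j τ - X k σ‖)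
    (hW0 : ∀ j, ‖X j 0‖ ≤ (Rwd + 1) * Real.sqrt Γ) (hW0ℓ : ∀ j, ‖X j 0‖ ≤ ℓ)
    (hfar : ∀ j τ, ℓ < ‖X j τ‖ → ⟪trueField Γ γ α X (X j τ), deriv (X j) τ⟫ ≠ 0)
    (hon : ∀ y : EuclideanSpace ℝ (Fin 3), ‖y‖ ≤ ℓ → switchedField Γ Rb γ α M 1 X y = trueField Γ γ α X y) :
    FlatJ1L N (δd / 2) (min (ρd / 4) (1 / 2)) Rb₁ (max (Λd + 1) 1) (Rwd + 1) Rb (1 / 2) (θd / 2) 1 Γ γ α X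
        (fun j τ => ⟪trueField Γ γ α X (X j τ), deriv (X j) τ⟫) (fun _ => 0) (fun _ _ => 1) ∧
      NearStraightJ1G N (max (Λd + 1) 1) Rb X (fun j τ => ⟪trueField Γ γ α X (X j τ), deriv (X j) τ⟫) (fun _ _ => 1) := by
  subst hℓdef
  have hθhalf : θd / 2 ≤ θd := by linarith
  have hθinv2 : θd⁻¹ ≤ (θd / 2)⁻¹ := by rw [inv_le_inv₀ hθd (by positivity)]; linarith
  have hcd : ∀ j, ContDiff ℝ 2 (X j) := fun j => (htan j).1
  have hun : ∀ j s, ‖deriv (X j) s‖ = 1 := fun j => (htan j).2.1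
  refine ⟨?_, ⟨fun j τ σ => (hosc j τ σ).trans (by linarith), fun j τ => ((hfine j).2.2.2.2.2 τ).trans (le_max_left _ _),
      fun j τ => inv_le_one_of_one_le₀ (le_max_right _ _)⟩⟩
  intro u v A T hu hv _hA _hT
  have hv' : ∀ y, v y = trueField Γ γ α X y := by
    intro y; rw [hv, hu]; simp only [trueField, bsField]
  refine ⟨?_, ?_, ?_, ?_, ?_, ?_, ?_, ?_, ?_, ?_, ?_, ?_, ?_, ?_⟩
  · exact abs_pos.1 (lt_of_lt_of_le hθd hranges.1)
  · exact fun j => abs_pos.1 (lt_of_lt_of_le hθd (hranges.2.2 j).1)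
  · exact fun j => ⟨hcd j, (hfine j).2.2.2.1, hun j, fun τ => ((hfine j).2.2.1 τ).trans hRbRb₁, (htan j).2.2.2.2.2.2⟩
  · intro j k hjk τ σ
    exact le_trans (mul_le_mul_of_nonneg_right (min_le_left _ _) hsΓ.le) (hsep j k hjk τ σ)
  · intro j τ σ _
    calc 1 / 2 * min (ρd / 4) (1 / 2) * Real.sqrt Γ = 1 / 2 * (min (ρd / 4) (1 / 2) * Real.sqrt Γ) := by ring
      _ ≤ 1 / 2 * |τ - σ| := by gcongr
      _ ≤ ‖X j τ - X j σ‖ := hchord j τ σ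
  · intro j τ
    show 1 / 2 * |τ - 0| ≤ (Rwd + 1) * Real.sqrt Γ + ‖X j τ‖
    have h1 := hchord j τ 0
    have h2 : ‖X j τ - X j 0‖ ≤ ‖X j τ‖ + ‖X j 0‖ := norm_sub_le _ _
    linarith [hW0 j]
  · intro j τ; rw [hv']
  · intro j τ hτ
    beta_reduce
    rw [hv', ← hon _ hτ]
    exact (htan j).2.2.1 τ
  · intro j; exact hW0 j
  · intro j
    show |⟪deriv (X j) 0, EuclideanSpace.single 2 1⟫| ≤ 1 - θd / 2
    have h1 : |⟪deriv (X j) 0 - t j, EuclideanSpace.single 2 1⟫| ≤ 3 * Rb / 8 := by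
      have := abs_real_inner_le_norm (deriv (X j) 0 - t j) (EuclideanSpace.single 2 1)
      have he : ‖(EuclideanSpace.single (2 : Fin 3) (1 : ℝ))‖ = 1 := by simp
      rw [he, mul_one] at this
      exact this.trans (htilt' j 0)
    have h2 := htilt j
    have h3 : ⟪deriv (X j) 0, EuclideanSpace.single 2 1⟫ = ⟪deriv (X j) 0 - t j, EuclideanSpace.single 2 1⟫ +
        ⟪t j, EuclideanSpace.single 2 1⟫ := by rw [← inner_add_left, sub_add_cancel]
    rw [h3]
    refine (abs_add_le _ _).trans ?_
    linarith
  · exact ⟨hθhalf.trans hranges.1, hranges.2.1.trans hθinv2, fun j => ⟨hθhalf.trans (hranges.2.2 j).1,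
      (hranges.2.2 j).2.trans hθinv2⟩⟩
  · intro j
    refine ⟨?_, ?_, (hfine j).2.2.2.2.1, le_trans (le_abs_self _) (((hfine j).2.2.2.2.2 0).trans (le_max_left _ _))⟩
    · show ⟪trueField Γ γ α X (X j 0), deriv (X j) 0⟫ = 0
      rw [← hon _ (hW0ℓ j), (htan j).2.2.2.1, inner_zero_left]
    · intro τ hw
      by_cases hτ : ‖X j τ‖ ≤ Rb * Real.sqrt (Γ * Real.log Γ)
      · have h := (hreg j).2.1 τ
        rw [hon _ hτ] at h
        exact h hw
      · exact absurd hw (hfar j τ (lt_of_not_ge hτ))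
  · intro j
    refine ⟨differentiable_const _, fun _ => one_pos, ?_, fun _ _ => rfl⟩
    show (1:ℝ) ≤ 1 * 1
    norm_num
  · intro j τ
    show (Rwd + 1) ^ 2 * Γ * 1 ≤ 1 * ((Rwd + 1) ^ 2 * Γ + ‖X j τ‖ ^ 2)
    nlinarith [sq_nonneg ‖X j τ‖]

/-- **Stub D, frame-currency-free core.**  The `FlatOutputL` text with the frame hypothesis replaced by the three facts D actually uses of the
reference skeleton `x` — waists `x_j 0 = √Γ(p_j + s₀_j t_j)`, datum tilt `‖x_j′ − t_j‖ ≤ Rb/8`, separation `(ρd/2)√Γ` — (the outer model is not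
used by D); both the record's `AdmissibleFrame` and the lead's reshaped `SlicedFrame` supply them. [folklore] -/
theorem flatOutputL_core :
    ∀ (N : ℕ) (δd ρd Λd Rwd θd mw : ℝ) (p t : Fin N → EuclideanSpace ℝ (Fin 3)) (γ : Fin N → ℝ) (α : ℝ) (s₀ : Fin N → ℝ),
    0 < N → 0 < δd → 0 < ρd → 0 < Rwd → 0 < θd → 0 < mw → StraightDatum N δd ρd Λd Rwd θd mw p t γ α s₀ →
    (∀ j k, j ≠ k → |⟪t j, t k⟫_ℝ| ≤ 1 - θd) →
    ∃ (δ ρ K Λ Rw cg θ₀ KA Rb₁ : ℝ), 0 < δ ∧ 0 < ρ ∧ 0 < Rw ∧ 0 < cg ∧ 0 < θ₀ ∧ 0 < Rb₁ ∧ 2 * K * ρ ≤ 1 ∧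
      ∀ lam Rb : ℝ, 0 < lam → 0 < Rb → Rb ≤ Rb₁ → ∃ Γ₃ : ℝ, ∀ Γ : ℝ, Γ₃ ≤ Γ →
        ∀ (x : Fin N → ℝ → EuclideanSpace ℝ (Fin 3)) (M : EuclideanSpace ℝ (Fin 3) → EuclideanSpace ℝ (Fin 3)),
          (∀ j, x j 0 = waistPt Γ p t s₀ j) → (∀ j τ, ‖deriv (x j) τ - t j‖ ≤ Rb / 8) →
          (∀ j k, j ≠ k → ∀ τ σ, ρd / 2 * Real.sqrt Γ ≤ ‖x j τ - x k σ‖) →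
          ∀ X : Fin N → ℝ → EuclideanSpace ℝ (Fin 3),
            FineClass Γ δd Λd Rb γ α x X → SwitchedTangent Γ Rb γ α M 1 X → RegularWaist Γ ρd Rb γ α x M 1 X →
            ∃ (w : Fin N → ℝ → ℝ) (c : Fin N → ℝ) (Aa : Fin N → ℝ → ℝ),
              FlatJ1L N δ ρ K Λ Rw Rb cg θ₀ KA Γ γ α X w c Aa ∧ NearStraightJ1G N Λ Rb X w Aa := by
  intro N δd ρd Λd Rwd θd mw p t γ α s₀ hN hδd hρd hRwd hθd hmw hSD hGP
  obtain ⟨ht1, -, htilt, hranges, hwaist, -⟩ := hSD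
  have hθinv : 0 < θd⁻¹ := inv_pos.2 hθd
  -- the tolerance ceiling
  set Rb₁ : ℝ := min (θd / 6) (min (ρd / 8) 1) with hRb₁
  have hRb₁pos : 0 < Rb₁ := lt_min (by positivity) (lt_min (by positivity) one_pos)
  have hρpos : 0 < min (ρd / 4) (1 / 2 : ℝ) := lt_min (by positivity) (by norm_num)
  refine ⟨δd / 2, min (ρd / 4) (1 / 2), Rb₁, max (Λd + 1) 1, Rwd + 1, 1 / 2, θd / 2, 1, Rb₁, by positivity, hρpos,
    by positivity, by norm_num, by positivity, hRb₁pos, ?_, ?_⟩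
  · have h1 : Rb₁ ≤ 1 := (min_le_right _ _).trans (min_le_right _ _)
    have h2 : min (ρd / 4) (1 / 2 : ℝ) ≤ 1 / 2 := min_le_right _ _
    nlinarith [hRb₁pos, hρpos]
  intro lam Rb hlam hRb hRbRb₁
  have hRbθ : Rb ≤ θd / 6 := hRbRb₁.trans (min_le_left _ _)
  have hRbρ : Rb ≤ ρd / 8 := hRbRb₁.trans ((min_le_right _ _).trans (min_le_left _ _))
  have hRb1 : Rb ≤ 1 := hRbRb₁.trans ((min_le_right _ _).trans (min_le_right _ _))
  -- the uniform tangential Biot–Savart constant and the threshold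
  set Cu : ℝ := N * θd⁻¹ * (4 * Rb + 32 / (Real.pi * ρd)) with hCu
  have hCu0 : 0 ≤ Cu := by positivity
  set Q : ℝ := (Rwd + 1) * (5 + 8 * θd⁻¹) + 8 * Cu + 1 with hQ
  have hQpos : 0 < Q := by positivity
  refine ⟨Real.exp ((Q / Rb) ^ 2 + 1), fun Γ hΓ => ?_⟩
  obtain ⟨hΓ1, hℓQ⟩ := threshold_ball hRb hQpos hΓ
  have hΓpos : 0 < Γ := by linarith
  have hsΓ : 0 < Real.sqrt Γ := Real.sqrt_pos.2 hΓpos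
  have hℓpos : 0 < Rb * Real.sqrt (Γ * Real.log Γ) := lt_trans (by positivity) hℓQ
  intro x M hxw hreft hrefsep X hfine htan hreg
  -- basic regularity
  have hcd : ∀ j, ContDiff ℝ 2 (X j) := fun j => (htan j).1
  have hcd1 : ∀ j, ContDiff ℝ 1 (X j) := fun j => (hcd j).of_le (by norm_num)
  have hun : ∀ j s, ‖deriv (X j) s‖ = 1 := fun j => (htan j).2.1
  have hosc : ∀ j u v, ‖deriv (X j) u - deriv (X j) v‖ ≤ 3 * Rb / 4 := fun j => fine_osc hfine hreft j
  have hε1 : 3 * Rb / 4 ≤ 1 := by linarith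
  have hchord : ∀ j u s, 1 / 2 * |u - s| ≤ ‖X j u - X j s‖ := by
    intro j u s
    have h := chord_arc_of_osc (hcd1 j) (hun j) (hosc j) u s
    have hc : (1:ℝ) / 2 ≤ 1 - (3 * Rb / 4) ^ 2 / 2 := by nlinarith
    exact le_trans (mul_le_mul_of_nonneg_right hc (abs_nonneg _)) h
  have hsep : ∀ j k, j ≠ k → ∀ τ σ, ρd / 4 * Real.sqrt Γ ≤ ‖X j τ - X k σ‖ := by
    intro j k hjk τ σ
    have h := fine_sep hfine hrefsep hjk τ σ
    have : ρd / 4 * Real.sqrt Γ ≤ (ρd / 2 - 2 * Rb) * Real.sqrt Γ := mul_le_mul_of_nonneg_right (by linarith) hsΓ.le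
    exact this.trans h
  have hW0 : ∀ j, ‖X j 0‖ ≤ (Rwd + 1) * Real.sqrt Γ := by
    intro j
    have h1 := fine_waist_norm hfine j
    have h2 : ‖x j 0‖ ≤ Rwd * Real.sqrt Γ := by
      rw [hxw j]; unfold waistPt
      rw [norm_smul, Real.norm_of_nonneg hsΓ.le, mul_comm]
      exact mul_le_mul_of_nonneg_right (hwaist j) hsΓ.le
    nlinarith [hsΓ]
  have hcurv : ∀ k s, ‖deriv (deriv (X k)) s‖ ≤ Rb / Real.sqrt Γ := fun k s => fine_curv hfine hΓpos k s
  have hγ : ∀ k, |γ k| ≤ θd⁻¹ := fun k => (hranges.2.2 k).2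
  -- the tangential Biot–Savart bound, uniform along the arms
  have hB : ∀ j τ, |⟪bsField Γ γ X (X j τ), deriv (X j) τ⟫| ≤ Cu * Real.sqrt Γ := by
    intro j τ
    have h := abs_inner_bsField_le hcd hun (κ₀ := Rb / Real.sqrt Γ) (c := 1 / 2) (d := ρd / 4 * Real.sqrt Γ) (G := θd⁻¹)
      (div_pos hRb hsΓ) hcurv (by norm_num) (by norm_num) hchord (by positivity) hsep hγ hΓpos.le j τ
    have hval : (N : ℝ) * (Γ * θd⁻¹ / (4 * Real.pi) * (2 * Real.pi * (Rb / Real.sqrt Γ) / (1 / 2) ^ 3 +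
        16 / (1 / 2 * (ρd / 4 * Real.sqrt Γ)))) = Cu * Real.sqrt Γ := by
      have hΓs : Γ = Real.sqrt Γ * Real.sqrt Γ := (Real.mul_self_sqrt hΓpos.le).symm
      rw [hCu]
      generalize hs : Real.sqrt Γ = s at hΓs ⊢
      have hs0 : s ≠ 0 := by rw [← hs]; exact hsΓ.ne'
      rw [hΓs]
      field_simp
      ring
    rw [hval] at h; exact h
  -- the waist lies in the crux ball; the far slip does not vanish
  have hQ1 : Rwd + 1 ≤ Q := by
    have : (Rwd + 1) * 1 ≤ (Rwd + 1) * (5 + 8 * θd⁻¹) :=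
      mul_le_mul_of_nonneg_left (by linarith) (by linarith)
    linarith
  have hW0ℓ : ∀ j, ‖X j 0‖ ≤ Rb * Real.sqrt (Γ * Real.log Γ) := fun j =>
    (hW0 j).trans ((mul_le_mul_of_nonneg_right hQ1 hsΓ.le).trans hℓQ.le)
  have hαε : |α| * (3 * Rb / 4) ≤ 1 / 8 := by
    calc |α| * (3 * Rb / 4) ≤ θd⁻¹ * (3 * (θd / 6) / 4) := by gcongr; exact hranges.2.1
      _ = 1 / 8 := by field_simp; ring
  have hfar : ∀ j τ, Rb * Real.sqrt (Γ * Real.log Γ) < ‖X j τ‖ → ⟪trueField Γ γ α X (X j τ), deriv (X j) τ⟫ ≠ 0 := by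
    intro j τ hτ
    refine trueSlip_ne_zero_of_far (hcd1 j) (hun j) (hosc j) hε1 hαε (hB j) ?_ hτ
    have e1 : ‖X j 0‖ * (5 + 8 * |α|) ≤ (Rwd + 1) * Real.sqrt Γ * (5 + 8 * θd⁻¹) :=
      mul_le_mul (hW0 j) (by linarith [hranges.2.1]) (by positivity) (by positivity)
    calc ‖X j 0‖ + 8 * ((1 / 2 + |α|) * ‖X j 0‖ + Cu * Real.sqrt Γ) = ‖X j 0‖ * (5 + 8 * |α|) + 8 * Cu * Real.sqrt Γ := by ring
      _ ≤ (Rwd + 1) * Real.sqrt Γ * (5 + 8 * θd⁻¹) + 8 * Cu * Real.sqrt Γ := by linarith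
      _ = (Q - 1) * Real.sqrt Γ := by rw [hQ]; ring
      _ < Q * Real.sqrt Γ := by nlinarith
      _ < Rb * Real.sqrt (Γ * Real.log Γ) := hℓQ
  -- on the crux ball the switched field is the true field
  have hon : ∀ y : EuclideanSpace ℝ (Fin 3), ‖y‖ ≤ Rb * Real.sqrt (Γ * Real.log Γ) →
      switchedField Γ Rb γ α M 1 X y = trueField Γ γ α X y := by
    intro y hy
    have hw : switchWeight (Rb * Real.sqrt (Γ * Real.log Γ)) 1 y = 1 :=
      switchWeight_eq_one_of_sq_le hℓpos.ne' (by
        rw [show (2:ℝ) * 1 - 1 = 1 by norm_num, one_mul]; exact pow_le_pow_left₀ (norm_nonneg y) hy 2)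
    simp [switchedField, hw]
  exact ⟨_, _, _, flatJ1L_of_facts hθd hranges htilt hsΓ hRb hRbRb₁ hRbθ rfl hfine htan hreg (fine_tilt hfine hreft) hosc hchord
    hsep hW0 hW0ℓ hfar hon⟩


/-- **Stub D in the record's currency (`AdmissibleFrame`; skeleton `streamline_kantorovich_R` sha16 `cbdaf3778dcf417e`, also the shelf line
`lia_switchoff_degree_R`): the `FlatOutputL` text VERBATIM as the goal type.** (route-posited stub statement, proved; not a Literature fact) [folklore] -/
theorem flatOutputL_of_frame :
    ∀ (N : ℕ) (δd ρd Λd Rwd θd mw : ℝ) (p t : Fin N → EuclideanSpace ℝ (Fin 3)) (γ : Fin N → ℝ) (α : ℝ) (s₀ : Fin N → ℝ),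
    0 < N → 0 < δd → 0 < ρd → 0 < Rwd → 0 < θd → 0 < mw → StraightDatum N δd ρd Λd Rwd θd mw p t γ α s₀ →
    (∀ j k, j ≠ k → |⟪t j, t k⟫_ℝ| ≤ 1 - θd) →
    ∃ (δ ρ K Λ Rw cg θ₀ KA Rb₁ : ℝ), 0 < δ ∧ 0 < ρ ∧ 0 < Rw ∧ 0 < cg ∧ 0 < θ₀ ∧ 0 < Rb₁ ∧ 2 * K * ρ ≤ 1 ∧
      ∀ lam Rb : ℝ, 0 < lam → 0 < Rb → Rb ≤ Rb₁ → ∃ Γ₃ : ℝ, ∀ Γ : ℝ, Γ₃ ≤ Γ →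
        ∀ (x : Fin N → ℝ → EuclideanSpace ℝ (Fin 3)) (M : EuclideanSpace ℝ (Fin 3) → EuclideanSpace ℝ (Fin 3)),
          AdmissibleFrame Γ ρd lam Rb p t s₀ x M →
          ∀ X : Fin N → ℝ → EuclideanSpace ℝ (Fin 3),
            FineClass Γ δd Λd Rb γ α x X → SwitchedTangent Γ Rb γ α M 1 X → RegularWaist Γ ρd Rb γ α x M 1 X →
            ∃ (w : Fin N → ℝ → ℝ) (c : Fin N → ℝ) (Aa : Fin N → ℝ → ℝ),
              FlatJ1L N δ ρ K Λ Rw Rb cg θ₀ KA Γ γ α X w c Aa ∧ NearStraightJ1G N Λ Rb X w Aa := by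
  intro N δd ρd Λd Rwd θd mw p t γ α s₀ hN hδd hρd hRwd hθd hmw hSD hGP
  obtain ⟨δ, ρ, K, Λ, Rw, cg, θ₀, KA, Rb₁, h1, h2, h3, h4, h5, h6, h7, hmain⟩ :=
    flatOutputL_core N δd ρd Λd Rwd θd mw p t γ α s₀ hN hδd hρd hRwd hθd hmw hSD hGP
  refine ⟨δ, ρ, K, Λ, Rw, cg, θ₀, KA, Rb₁, h1, h2, h3, h4, h5, h6, h7, fun lam Rb hlam hRb hRb₁ => ?_⟩
  obtain ⟨Γ₃, hΓ₃⟩ := hmain lam Rb hlam hRb hRb₁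
  exact ⟨Γ₃, fun Γ hΓ x M hframe X hfine htan hreg =>
    hΓ₃ Γ hΓ x M (fun j => (hframe.1.1 j).2.2) hframe.1.2.1 hframe.1.2.2.2.1 X hfine htan hreg⟩

/-- **Stub D in the lead's reshaped currency (`SlicedFrame`, `…SkeletonJ1RFrameDefs` §5): the same text with `AdmissibleFrame ↦ SlicedFrame`.**
(route-posited stub statement, proved; not a Literature fact) [folklore] -/
theorem flatOutputL_of_slicedFrame :
    ∀ (N : ℕ) (δd ρd Λd Rwd θd mw : ℝ) (p t : Fin N → EuclideanSpace ℝ (Fin 3)) (γ : Fin N → ℝ) (α : ℝ) (s₀ : Fin N → ℝ),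
    0 < N → 0 < δd → 0 < ρd → 0 < Rwd → 0 < θd → 0 < mw → StraightDatum N δd ρd Λd Rwd θd mw p t γ α s₀ →
    (∀ j k, j ≠ k → |⟪t j, t k⟫_ℝ| ≤ 1 - θd) →
    ∃ (δ ρ K Λ Rw cg θ₀ KA Rb₁ : ℝ), 0 < δ ∧ 0 < ρ ∧ 0 < Rw ∧ 0 < cg ∧ 0 < θ₀ ∧ 0 < Rb₁ ∧ 2 * K * ρ ≤ 1 ∧
      ∀ lam Rb : ℝ, 0 < lam → 0 < Rb → Rb ≤ Rb₁ → ∃ Γ₃ : ℝ, ∀ Γ : ℝ, Γ₃ ≤ Γ →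
        ∀ (x : Fin N → ℝ → EuclideanSpace ℝ (Fin 3)) (M : EuclideanSpace ℝ (Fin 3) → EuclideanSpace ℝ (Fin 3)),
          SlicedFrame Γ ρd lam Rb p t s₀ x M →
          ∀ X : Fin N → ℝ → EuclideanSpace ℝ (Fin 3),
            FineClass Γ δd Λd Rb γ α x X → SwitchedTangent Γ Rb γ α M 1 X → RegularWaist Γ ρd Rb γ α x M 1 X →
            ∃ (w : Fin N → ℝ → ℝ) (c : Fin N → ℝ) (Aa : Fin N → ℝ → ℝ),
              FlatJ1L N δ ρ K Λ Rw Rb cg θ₀ KA Γ γ α X w c Aa ∧ NearStraightJ1G N Λ Rb X w Aa := by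
  intro N δd ρd Λd Rwd θd mw p t γ α s₀ hN hδd hρd hRwd hθd hmw hSD hGP
  obtain ⟨δ, ρ, K, Λ, Rw, cg, θ₀, KA, Rb₁, h1, h2, h3, h4, h5, h6, h7, hmain⟩ :=
    flatOutputL_core N δd ρd Λd Rwd θd mw p t γ α s₀ hN hδd hρd hRwd hθd hmw hSD hGP
  refine ⟨δ, ρ, K, Λ, Rw, cg, θ₀, KA, Rb₁, h1, h2, h3, h4, h5, h6, h7, fun lam Rb hlam hRb hRb₁ => ?_⟩
  obtain ⟨Γ₃, hΓ₃⟩ := hmain lam Rb hlam hRb hRb₁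
  exact ⟨Γ₃, fun Γ hΓ x M hframe X hfine htan hreg =>
    hΓ₃ Γ hΓ x M (fun j => (hframe.1.1 j).2.2) hframe.1.2.1 hframe.1.2.2.2 X hfine htan hreg⟩

end Summit.NavierStokesRegularity.NavierStokesRegularity.Theorems.SkeletonJ1RFlatOutput

namespace Summit.NavierStokesRegularity.NavierStokesRegularity.Theorems.SkeletonJ1RFrame

/-- **STUB D `stub_flatOutputL : FlatOutputL` of the registered `SkeletonJ1R` line `streamline_kantorovich_R`, BY NAME** over the lead's
`…SkeletonJ1RLineDefs.FlatOutputL` (p715100; datum-SLICED frame currency `SlicedFrame`): a fine switched-tangent skeleton at `s = 1` with regular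
waists, in a datum-sliced frame over a general-position straight datum, satisfies `FlatJ1L ∧ NearStraightJ1G` with the true slip, `c := 0`,
`Aa := 1`.  Proof term: `flatOutputL_of_slicedFrame` (its statement is that text verbatim, accepted by `δ`-unfolding `FlatOutputL`); the
Admissible-currency twin of the record skeleton text cbdaf3778dcf is `flatOutputL_of_frame`. (route-posited stub statement, proved; not a
Literature fact) [folklore] -/
theorem stub_flatOutputL : FlatOutputL :=
  Summit.NavierStokesRegularity.NavierStokesRegularity.Theorems.SkeletonJ1RFlatOutput.flatOutputL_of_slicedFrame

end Summit.NavierStokesRegularity.NavierStokesRegularity.Theorems.SkeletonJ1RFrame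

end
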